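import Literature.NumberTheory.LFunctions.WeilArchimedeanMoments
import Literature.NumberTheory.LFunctions.KadiriDigammaBounds
import Mathlib.Analysis.SpecialFunctions.Trigonometric.ArctanDeriv

/-!
# Stub `stub_archBathtub` (line `Sketch`, crux `WeilComb.CombShapePositivity`, stmt-RiemannHypothesis-11229)
# — siege k4 (generation 1), variation: direct integral estimate with interval bounds

For a Weil test `g` with `L = ‖g‖₁` (`weilNorm1`), `N = ‖g‖₂²` (`weilNorm2Sq`), `0 < L` and `2L² ≤ πN`:

`N (log(N/(2L²)) − 1) − (21/(5π)) L² ≤ Re W_∞(g ⋆ g̃)`,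

in fact with `23/(10π)` in place of `21/(5π)` (`re_weilArchTerm_autocorr_ge_direct`).

The digamma integral `∫_{−T}^{T} ρ`, `ρ(u) = Re ψ(1/4 + iu/2)` (`reDigammaQuarter`), is estimated DIRECTLY:
one explicit two-piece minorant of `ρ` on `[0, ∞)` is integrated in closed form (two applications of the
fundamental theorem of calculus, no staircase, no `arg Γ`):

* on `[0, 2]` the first term of the vertical series (`sum_digammaTerm_le`) and the certified value
  `ψ(¼) ≥ −4.22745354` (`re_digamma_one_quarter_ge`) give `ρ(u) ≥ ψ₀ + 4 − 4/(1 + 4u²)`,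
  `ψ₀ = −4.22745354`, with primitive `ψ₀ u + 4u − 2 arctan(2u)`: `∫₀² ρ ≥ 2ψ₀ + 8 − 2 arctan 4`
  (`integral_head_ge`);
* on `[2, T]` Kadiri's second-order Stirling minorant (`KadiriDigamma.re_digamma_ge` at `X = ¼`, `Y = u/2`)
  reads `ρ(u) ≥ log(u/2) − 2/(1 + 4u²) − π/(3u²) − 4/(3u³)`, with primitive
  `u log(u/2) − u − arctan(2u) + π/(3u) + 2/(3u²)`:
  `∫₂^T ρ ≥ T log(T/2) − T + 2 + arctan 4 − arctan(2T) − π/6 − 1/6` (`integral_tail_ge`);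
* `arctan < π/2` twice and evenness (`reDigammaQuarter_even`):
  `∫_{−T}^{T} ρ ≥ 2T(log(T/2) − 1) − 23/5` for `T ≥ 2` (`integral_symm_ge`; the stub needs `42/5`).

The rest is the bathtub rearrangement (`bathtub_level`: `0 ≤ |ĝ(1/2+iu)|² ≤ L²`, `∫ |ĝ|² = 2πN` by Plancherel,
`ρ` increasing in `|u|`, level `T = πN/L²`) and `Re W_∞(g ⋆ g̃) = (1/2π) ∫ |ĝ|² ρ − N log π`
(`weilArchIntegral_weilConv_weilReflect`, `weilConv_weilReflect_apply_zero`).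

The file lives in the sub-namespace `…WeilCombBohrFejer.ArchDirect` so that `stub_archBathtub` keeps its
registered name and signature.
-/

noncomputable section

-- the sub-problem path RiemannHypothesis/RiemannHypothesis duplicates a namespace (D-0017)
set_option linter.dupNamespace false

open scoped BigOperators ComplexConjugate
open Complex MeasureTheory Set

namespace Summit.RiemannHypothesis.RiemannHypothesis.Theorems.WeilCombBohrFejer.ArchDirect

open Literature.NumberTheory.LFunctions
open Literature.Analysis.SpecialFunctions (reDigammaQuarter reDigammaQuarter_even reDigammaQuarter_mono
  continuous_reDigammaQuarter reDigammaQuarter_zero sum_digammaTerm_le re_digamma_one_quarter_ge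
  digammaTerm digammaNode)

/-! ### 1. The two-piece minorant of `ρ(u) = Re ψ(1/4 + iu/2)` -/

/-- Head minorant (all `u`): `ψ₀ + 4 − 4/(1 + 4u²) ≤ ρ(u)` with `ψ₀ = −4.22745354 ≤ ψ(¼)` — the first term
`f_{1/2}(u) = 16u²/(1 + 4u²)` of the vertical series `ρ(u) − ψ(¼) = Σ_m f_{l_m}(u)`. [folklore] -/
theorem reDigammaQuarter_ge_head (u : ℝ) :
    -4.22745354 + (4 - 4 / (1 + 4 * u ^ 2)) ≤ reDigammaQuarter u := by
  have h := sum_digammaTerm_le 1 u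
  rw [Finset.sum_range_one] at h
  have h0 : (-4.22745354 : ℝ) ≤ reDigammaQuarter 0 := by
    rw [reDigammaQuarter_zero]; exact re_digamma_one_quarter_ge
  have h1 : (0 : ℝ) < 1 + 4 * u ^ 2 := by positivity
  have ht : digammaTerm (digammaNode 0) u = 4 - 4 / (1 + 4 * u ^ 2) := by
    simp only [digammaTerm, digammaNode, Nat.cast_zero, mul_zero, zero_add]
    field_simp
    ring
  linarith

/-- Tail minorant (`u > 0`): `log(u/2) − 2/(1 + 4u²) − π/(3u²) − 4/(3u³) ≤ ρ(u)` — Kadiri's lower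
Stirling bound `Re ψ(X + iY) ≥ log Y − X/(2(X² + Y²)) − 1/(6Y³) − π/(12Y²)` at `X = 1/4`, `Y = u/2`. [folklore] -/
theorem reDigammaQuarter_ge_tail {u : ℝ} (hu : 0 < u) :
    Real.log (u / 2) - 2 / (1 + 4 * u ^ 2) - Real.pi / (3 * u ^ 2) - 4 / (3 * u ^ 3) ≤
      reDigammaQuarter u := by
  have h := KadiriDigamma.re_digamma_ge (X := 1 / 4) (Y := u / 2) (by norm_num) (by positivity)
  have e : (((1 / 4 : ℝ) : ℂ) + ((u / 2 : ℝ) : ℂ) * I) = 1 / 4 + u / 2 * I := by push_cast; ring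
  rw [e] at h
  have hu0 : u ≠ 0 := hu.ne'
  have h1 : (1 + 4 * u ^ 2 : ℝ) ≠ 0 := by positivity
  have h2 : ((1 / 4 : ℝ) ^ 2 + (u / 2) ^ 2) ≠ 0 := by positivity
  have e1 : (1 / 4 : ℝ) / (2 * ((1 / 4) ^ 2 + (u / 2) ^ 2)) = 2 / (1 + 4 * u ^ 2) := by
    field_simp; ring
  have e2 : 1 / (6 * (u / 2) ^ 3) = 4 / (3 * u ^ 3) := by field_simp; ring
  have e3 : Real.pi / (12 * (u / 2) ^ 2) = Real.pi / (3 * u ^ 2) := by field_simp; ring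
  rw [e1, e2, e3] at h
  unfold reDigammaQuarter
  linarith

/-! ### 2. The two closed-form integrals -/

/-- Head integral: `2ψ₀ + 8 − 2 arctan 4 ≤ ∫₀² ρ` (primitive `ψ₀ u + 4u − 2 arctan(2u)` of the head
minorant). [folklore] -/
theorem integral_head_ge :
    2 * (-4.22745354 : ℝ) + 8 - 2 * Real.arctan 4 ≤ ∫ u in (0 : ℝ)..2, reDigammaQuarter u := by
  set P : ℝ → ℝ := fun u => (-4.22745354 : ℝ) * u + 4 * u - 2 * Real.arctan (2 * u) with hP
  have hderiv : ∀ x ∈ uIcc (0 : ℝ) 2,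
      HasDerivAt P (-4.22745354 + (4 - 4 / (1 + 4 * x ^ 2))) x := by
    intro x _
    have h1 : HasDerivAt (fun u : ℝ => 2 * u) 2 x := by
      simpa using (hasDerivAt_id x).const_mul (2 : ℝ)
    have h2 : HasDerivAt (fun u : ℝ => Real.arctan (2 * u)) (1 / (1 + (2 * x) ^ 2) * 2) x :=
      (Real.hasDerivAt_arctan (2 * x)).comp x h1
    have h3 : HasDerivAt (fun u : ℝ => (-4.22745354 : ℝ) * u + 4 * u - 2 * Real.arctan (2 * u))
        ((-4.22745354 : ℝ) * 1 + 4 * 1 - 2 * (1 / (1 + (2 * x) ^ 2) * 2)) x :=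
      (((hasDerivAt_id' x).const_mul (-4.22745354 : ℝ)).add
        ((hasDerivAt_id' x).const_mul 4)).sub (h2.const_mul 2)
    refine h3.congr_deriv ?_
    have hx : (1 + 4 * x ^ 2 : ℝ) ≠ 0 := by positivity
    have hx' : (1 + (2 * x) ^ 2 : ℝ) ≠ 0 := by positivity
    field_simp
    ring
  have hint : IntervalIntegrable (fun x : ℝ => (-4.22745354 : ℝ) + (4 - 4 / (1 + 4 * x ^ 2)))
      volume 0 2 := by
    refine Continuous.intervalIntegrable ?_ _ _
    exact continuous_const.add (continuous_const.sub
      (continuous_const.div (by fun_prop) fun x => by positivity))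
  have hFTC := intervalIntegral.integral_eq_sub_of_hasDerivAt hderiv hint
  have hmono := intervalIntegral.integral_mono_on (by norm_num : (0 : ℝ) ≤ 2) hint
    (continuous_reDigammaQuarter.intervalIntegrable _ _) fun x _ => reDigammaQuarter_ge_head x
  rw [hFTC] at hmono
  have hP2 : P 2 - P 0 = 2 * (-4.22745354 : ℝ) + 8 - 2 * Real.arctan 4 := by
    simp only [hP]
    norm_num [Real.arctan_zero]
  linarith

/-- Tail integral (`T ≥ 2`): `T log(T/2) − T + 2 + arctan 4 − arctan(2T) − π/6 − 1/6 ≤ ∫₂^T ρ`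
(primitive `u log(u/2) − u − arctan(2u) + π/(3u) + 2/(3u²)` of the tail minorant; the positive
boundary terms `π/(3T) + 2/(3T²)` dropped). [folklore] -/
theorem integral_tail_ge {T : ℝ} (hT : 2 ≤ T) :
    T * Real.log (T / 2) - T + 2 + Real.arctan 4 - Real.arctan (2 * T) - Real.pi / 6 - 1 / 6 ≤
      ∫ u in (2 : ℝ)..T, reDigammaQuarter u := by
  set κ : ℝ → ℝ := fun u =>
    Real.log (u / 2) - 2 / (1 + 4 * u ^ 2) - Real.pi / (3 * u ^ 2) - 4 / (3 * u ^ 3) with hκ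
  set P : ℝ → ℝ := fun u => u * Real.log (u / 2) - u - Real.arctan (2 * u) + Real.pi / 3 * u⁻¹ +
    2 / 3 * (u ^ 2)⁻¹ with hP
  have hderiv : ∀ x ∈ uIcc (2 : ℝ) T, HasDerivAt P (κ x) x := by
    intro x hx
    rw [uIcc_of_le hT] at hx
    have hx0 : 0 < x := by linarith [hx.1]
    have hlog : HasDerivAt (fun y : ℝ => Real.log (y / 2)) ((1 / 2) / (x / 2)) x := by
      have h1 : HasDerivAt (fun y : ℝ => y / 2) (1 / 2) x := by
        simpa using (hasDerivAt_id x).div_const (2 : ℝ)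
      exact h1.log (by positivity)
    have hmul : HasDerivAt (fun y : ℝ => y * Real.log (y / 2))
        (1 * Real.log (x / 2) + x * ((1 / 2) / (x / 2))) x := (hasDerivAt_id' x).mul hlog
    have hatan : HasDerivAt (fun y : ℝ => Real.arctan (2 * y)) (1 / (1 + (2 * x) ^ 2) * 2) x := by
      have h1 : HasDerivAt (fun u : ℝ => 2 * u) 2 x := by
        simpa using (hasDerivAt_id x).const_mul (2 : ℝ)
      exact (Real.hasDerivAt_arctan (2 * x)).comp x h1
    have hall : HasDerivAt (fun y : ℝ => y * Real.log (y / 2) - y - Real.arctan (2 * y) +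
          Real.pi / 3 * y⁻¹ + 2 / 3 * (y ^ 2)⁻¹)
        (1 * Real.log (x / 2) + x * ((1 / 2) / (x / 2)) - 1 - 1 / (1 + (2 * x) ^ 2) * 2 +
          Real.pi / 3 * (-(x ^ 2)⁻¹) + 2 / 3 * (-(↑(2 : ℕ) * x ^ (2 - 1)) / (x ^ 2) ^ 2)) x :=
      (((hmul.sub (hasDerivAt_id' x)).sub hatan).add ((hasDerivAt_inv hx0.ne').const_mul _)).add
        (((hasDerivAt_pow 2 x).inv (by positivity)).const_mul (2 / 3))
    refine hall.congr_deriv ?_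
    have hx' : x ≠ 0 := hx0.ne'
    have hx4 : (1 + 4 * x ^ 2 : ℝ) ≠ 0 := by positivity
    have hx4' : (1 + (2 * x) ^ 2 : ℝ) ≠ 0 := by positivity
    simp only [hκ, Nat.cast_ofNat, Nat.add_one_sub_one, pow_one]
    field_simp
    ring
  have hint : IntervalIntegrable κ volume 2 T := by
    refine ContinuousOn.intervalIntegrable ?_
    rw [uIcc_of_le hT]
    intro x hx
    have hx0 : 0 < x := by linarith [hx.1]
    have hx0' : x ≠ 0 := hx0.ne'
    have hx2 : x / 2 ≠ 0 := by positivity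
    have hx4 : (1 + 4 * x ^ 2 : ℝ) ≠ 0 := by positivity
    simp only [hκ]
    exact ContinuousAt.continuousWithinAt (by fun_prop (disch := positivity))
  have hFTC := intervalIntegral.integral_eq_sub_of_hasDerivAt hderiv hint
  have hmono := intervalIntegral.integral_mono_on hT hint
    (continuous_reDigammaQuarter.intervalIntegrable _ _) fun x hx =>
      reDigammaQuarter_ge_tail (by linarith [hx.1])
  rw [hFTC] at hmono
  have hT0 : 0 < T := by linarith
  have hP2 : P 2 = -2 - Real.arctan 4 + Real.pi / 6 + 1 / 6 := by
    simp only [hP]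
    norm_num
    ring
  have hPT : T * Real.log (T / 2) - T - Real.arctan (2 * T) ≤ P T := by
    simp only [hP]
    have h1 : 0 ≤ Real.pi / 3 * T⁻¹ := by positivity
    have h2 : 0 ≤ 2 / 3 * (T ^ 2)⁻¹ := by positivity
    linarith
  linarith

/-- **Direct estimate of the digamma integral.** For `T ≥ 2`:
`2T(log(T/2) − 1) − 23/5 ≤ ∫_{−T}^{T} Re ψ(1/4 + iu/2) du` (evenness, `integral_head_ge`,
`integral_tail_ge`, `arctan < π/2`, `π < 3.1416`). [folklore] -/
theorem integral_symm_ge {T : ℝ} (hT : 2 ≤ T) :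
    2 * T * (Real.log (T / 2) - 1) - 23 / 5 ≤ ∫ u in (-T)..T, reDigammaQuarter u := by
  have hc : Continuous reDigammaQuarter := continuous_reDigammaQuarter
  have hii : ∀ a b : ℝ, IntervalIntegrable reDigammaQuarter volume a b := fun a b =>
    hc.intervalIntegrable a b
  have hneg : ∫ u in (-T)..0, reDigammaQuarter u = ∫ u in (0 : ℝ)..T, reDigammaQuarter u := by
    have h := intervalIntegral.integral_comp_neg reDigammaQuarter (a := 0) (b := T)
    simp only [neg_zero, reDigammaQuarter_even] at h
    exact h.symm
  have hsplit : ∫ u in (-T)..T, reDigammaQuarter u =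
      2 * ((∫ u in (0 : ℝ)..2, reDigammaQuarter u) + ∫ u in (2 : ℝ)..T, reDigammaQuarter u) := by
    rw [← intervalIntegral.integral_add_adjacent_intervals (hii (-T) 0) (hii 0 T), hneg,
      intervalIntegral.integral_add_adjacent_intervals (hii 0 2) (hii 2 T)]
    ring
  have h1 := integral_head_ge
  have h2 := integral_tail_ge hT
  have ha1 := Real.arctan_lt_pi_div_two 4
  have ha2 := Real.arctan_lt_pi_div_two (2 * T)
  have hpi := Real.pi_lt_d4
  rw [hsplit]
  nlinarith

/-! ### 3. The bathtub rearrangement -/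

/-- **Bathtub at an arbitrary level.** For a Weil test `g` with `L = ‖g‖₁`, `N = ‖g‖₂²` and every level
`T ≥ 0`: `L² ∫_{−T}^{T} ρ + ρ(T) (2πN − 2T L²) ≤ ∫ |ĝ(1/2+iu)|² ρ(u) du` (at the bathtub level `L² T = πN`
the correction vanishes). Pointwise `ρ(T) |ĝ|² + 1_{[−T,T]} L² (ρ − ρ(T)) ≤ |ĝ|² ρ` (`|ĝ|² ≤ L²` by
`norm_weilMellin_half_line_le`, `ρ` increasing in `|u|`); the integral of the left side is
`2πN ρ(T) + L² (∫_{−T}^{T} ρ − 2T ρ(T))` (Plancherel `∫ |ĝ|² = 2πN`, `integral_norm_sq_weilMellin_half_line`).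
[folklore] -/
theorem bathtub_level {g : ℝ → ℂ} (hg : IsWeilTest g) {T : ℝ} (hT0 : 0 ≤ T) :
    weilNorm1 g ^ 2 * (∫ u in (-T)..T, reDigammaQuarter u) +
        reDigammaQuarter T * (2 * Real.pi * weilNorm2Sq g - 2 * T * weilNorm1 g ^ 2) ≤
      ∫ u : ℝ, ‖weilMellin g (1 / 2 + u * I)‖ ^ 2 * reDigammaQuarter u := by
  set L2 : ℝ := weilNorm1 g ^ 2 with hL2
  set G : ℝ → ℝ := fun u => ‖weilMellin g (1 / 2 + u * I)‖ ^ 2 with hG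
  set ρT : ℝ := reDigammaQuarter T with hρT
  have hGi : Integrable G := integrable_norm_sq_weilMellin_half_line hg
  have hPl : ∫ u, G u = 2 * Real.pi * weilNorm2Sq g := integral_norm_sq_weilMellin_half_line hg
  have hGρ : Integrable fun u => G u * reDigammaQuarter u :=
    integrable_norm_sq_weilMellin_mul_reDigammaQuarter hg
  have hGle : ∀ u, G u ≤ L2 := fun u =>
    pow_le_pow_left₀ (norm_nonneg _) (norm_weilMellin_half_line_le hg u) 2
  have hG0 : ∀ u, 0 ≤ G u := fun u => by positivity
  have hc : Continuous reDigammaQuarter := continuous_reDigammaQuarter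
  have hTT : -T ≤ T := by linarith
  -- the minorant `h = ρ(T) G + 1_{[-T,T]} L² (ρ - ρ(T))`
  set k : ℝ → ℝ := (Icc (-T) T).indicator fun u => L2 * (reDigammaQuarter u - ρT) with hk
  have hkI : IntegrableOn (fun u => L2 * (reDigammaQuarter u - ρT)) (Icc (-T) T) :=
    (continuous_const.mul (hc.sub continuous_const)).continuousOn.integrableOn_Icc
  have hki : Integrable k := hkI.integrable_indicator measurableSet_Icc
  have hhi : Integrable fun u => ρT * G u + k u := (hGi.const_mul _).add hki
  have hpt : ∀ u, ρT * G u + k u ≤ G u * reDigammaQuarter u := by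
    intro u
    by_cases hu : u ∈ Icc (-T) T
    · have hku : k u = L2 * (reDigammaQuarter u - ρT) := indicator_of_mem hu _
      have hρu : reDigammaQuarter u ≤ ρT :=
        reDigammaQuarter_mono ((abs_le.2 ⟨hu.1, hu.2⟩).trans (le_abs_self T))
      have hprod : 0 ≤ (L2 - G u) * (ρT - reDigammaQuarter u) :=
        mul_nonneg (sub_nonneg.2 (hGle u)) (sub_nonneg.2 hρu)
      rw [hku]
      nlinarith
    · have hku : k u = 0 := indicator_of_notMem hu _
      have hTu : |T| ≤ |u| := by
        rw [abs_of_nonneg hT0]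
        simp only [mem_Icc, not_and_or, not_le] at hu
        rcases hu with h1 | h1
        · linarith [neg_abs_le u]
        · linarith [le_abs_self u]
      have hρu : ρT ≤ reDigammaQuarter u := reDigammaQuarter_mono hTu
      rw [hku, add_zero]
      nlinarith [hG0 u]
  have hmono : ∫ u, ρT * G u + k u ≤ ∫ u, G u * reDigammaQuarter u := integral_mono hhi hGρ hpt
  have hval : ∫ u, ρT * G u + k u = L2 * (∫ u in (-T)..T, reDigammaQuarter u) +
      ρT * (2 * Real.pi * weilNorm2Sq g - 2 * T * L2) := by
    rw [integral_add (hGi.const_mul _) hki, integral_const_mul, hPl, hk,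
      integral_indicator measurableSet_Icc, integral_Icc_eq_integral_Ioc,
      ← intervalIntegral.integral_of_le hTT, intervalIntegral.integral_const_mul,
      intervalIntegral.integral_sub (hc.intervalIntegrable _ _) intervalIntegrable_const,
      intervalIntegral.integral_const, smul_eq_mul]
    ring
  rw [hval] at hmono
  exact hmono

/-! ### 4. The archimedean diagonal -/

/-- **Bathtub bound with the direct constant.** For a Weil test `g` with `0 < ‖g‖₁` and
`2‖g‖₁² ≤ π‖g‖₂²`: `‖g‖₂² (log(‖g‖₂²/(2‖g‖₁²)) − 1) − (23/(10π)) ‖g‖₁² ≤ Re W_∞(g ⋆ g̃)`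
(`Re W_∞(g ⋆ g̃) = (1/2π) ∫ |ĝ|² ρ − ‖g‖₂² log π`, `bathtub_level` at the level `T = π‖g‖₂²/‖g‖₁² ≥ 2`,
`integral_symm_ge`, and `log(T/2) = log π + log(‖g‖₂²/(2‖g‖₁²))`). [folklore] -/
theorem re_weilArchTerm_autocorr_ge_direct {g : ℝ → ℂ} (hg : IsWeilTest g) (hL : 0 < weilNorm1 g)
    (hcond : 2 * weilNorm1 g ^ 2 ≤ Real.pi * weilNorm2Sq g) :
    weilNorm2Sq g * (Real.log (weilNorm2Sq g / (2 * weilNorm1 g ^ 2)) - 1) -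
        23 / (10 * Real.pi) * weilNorm1 g ^ 2 ≤
      (weilArchTerm (weilConv g (weilReflect g))).re := by
  set N := weilNorm2Sq g with hN
  set L := weilNorm1 g with hL'
  have hπ : 0 < Real.pi := Real.pi_pos
  have hL2 : 0 < L ^ 2 := by positivity
  have hN0 : 0 < N := pos_of_mul_pos_right (by linarith : 0 < Real.pi * N) hπ.le
  set T : ℝ := Real.pi * N / L ^ 2 with hT
  have hLT : L ^ 2 * T = Real.pi * N := by rw [hT]; field_simp
  have hT2 : 2 ≤ T := by rw [hT, le_div_iff₀ hL2]; linarith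
  set A : ℝ := ∫ u : ℝ, ‖weilMellin g (1 / 2 + u * I)‖ ^ 2 * reDigammaQuarter u with hA
  -- the archimedean term of `g ⋆ g̃`
  have harch : (weilArchTerm (weilConv g (weilReflect g))).re =
      1 / (2 * Real.pi) * A - N * Real.log Real.pi := by
    have e : weilArchTerm (weilConv g (weilReflect g)) =
        ((1 / (2 * Real.pi) * A - N * Real.log Real.pi : ℝ) : ℂ) := by
      unfold weilArchTerm
      rw [weilArchIntegral_weilConv_weilReflect hg, weilConv_weilReflect_apply_zero]
      have eA : (∫ t : ℝ, ‖weilMellin g (1 / 2 + t * I)‖ ^ 2 *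
          (Complex.digamma (1 / 4 + t / 2 * I)).re) = A := rfl
      have eN : (∫ t : ℝ, ‖g t‖ ^ 2) = N := rfl
      rw [eA, eN]
      push_cast
      ring
    rw [e, Complex.ofReal_re]
  -- bathtub and the direct digamma estimate
  have hbath : L ^ 2 * ∫ u in (-T)..T, reDigammaQuarter u ≤ A := by
    have h := bathtub_level hg (T := T) (by linarith)
    have e : 2 * Real.pi * N - 2 * T * L ^ 2 = 0 := by linarith [hLT, mul_comm (L ^ 2) T]
    rwa [e, mul_zero, add_zero] at h
  have hdig := integral_symm_ge hT2
  have hmono : 1 / (2 * Real.pi) * (L ^ 2 * (2 * T * (Real.log (T / 2) - 1) - 23 / 5)) ≤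
      1 / (2 * Real.pi) * A := by
    refine mul_le_mul_of_nonneg_left ?_ (by positivity)
    exact (mul_le_mul_of_nonneg_left hdig hL2.le).trans hbath
  -- algebra: `L² T = πN`, `log(T/2) = log π + log(N/(2L²))`
  have hq : 0 < N / (2 * L ^ 2) := by positivity
  have hlog : Real.log (T / 2) = Real.log Real.pi + Real.log (N / (2 * L ^ 2)) := by
    rw [← Real.log_mul hπ.ne' hq.ne']
    congr 1
    rw [hT]
    field_simp
  have key : 1 / (2 * Real.pi) * (L ^ 2 * (2 * T * (Real.log (T / 2) - 1) - 23 / 5)) =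
      N * (Real.log (N / (2 * L ^ 2)) - 1) + N * Real.log Real.pi - 23 / (10 * Real.pi) * L ^ 2 := by
    have e : L ^ 2 * (2 * T * (Real.log (T / 2) - 1) - 23 / 5) =
        2 * (Real.pi * N) * (Real.log (T / 2) - 1) - 23 / 5 * L ^ 2 := by
      rw [← hLT]; ring
    rw [e, hlog]
    field_simp
    ring
  rw [harch]
  linarith [key, hmono]

/-! ### 5. The registered stub -/

/-- **Stub S3 — bathtub bound for the archimedean diagonal of a Weil test** (registered signature of
line `Sketch`). For a Weil test `g` with `0 < ‖g‖₁` and `2‖g‖₁² ≤ π‖g‖₂²`: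
`‖g‖₂² (log(‖g‖₂²/(2‖g‖₁²)) − 1) − (21/(5π)) ‖g‖₁² ≤ Re W_∞(g ⋆ g̃)`
(from `re_weilArchTerm_autocorr_ge_direct`, `23/10 ≤ 21/5`). -/
theorem stub_archBathtub : ∀ g : ℝ → ℂ, IsWeilTest g → 0 < weilNorm1 g →
    2 * weilNorm1 g ^ 2 ≤ Real.pi * weilNorm2Sq g →
    weilNorm2Sq g * (Real.log (weilNorm2Sq g / (2 * weilNorm1 g ^ 2)) - 1) -
        21 / (5 * Real.pi) * weilNorm1 g ^ 2 ≤
      (weilArchTerm (weilConv g (weilReflect g))).re := by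
  intro g hg hL hcond
  have h := re_weilArchTerm_autocorr_ge_direct hg hL hcond
  have hπ : 0 < Real.pi := Real.pi_pos
  have hc : 23 / (10 * Real.pi) * weilNorm1 g ^ 2 ≤ 21 / (5 * Real.pi) * weilNorm1 g ^ 2 := by
    refine mul_le_mul_of_nonneg_right ?_ (sq_nonneg _)
    rw [div_le_div_iff₀ (by positivity) (by positivity)]
    nlinarith
  linarith

end Summit.RiemannHypothesis.RiemannHypothesis.Theorems.WeilCombBohrFejer.ArchDirect

end
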